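import Literature.Analysis.FluidPDE.TorusVelocityMomentPower
import Literature.Analysis.FluidPDE.TorusNSPressureGradientBudget
import Summits.NavierStokesRegularity.FunctionalMining.Candidates
import Summits.NavierStokesRegularity.FunctionalMining.VelocityL4Production
import HarnessLib

/-!
# FunctionalMining — K0 row `EV.s=4|T_LD|G1` HOLDS in the kernel: the saturating law
# `d/dt ∫|u|⁴ ≤ κ ν⁻⁵ ‖∇u‖₂² (∫|u|⁴)²` along classical Navier–Stokes solutions on `T³`

search for candidate a priori estimates; no regularity claim. Cell `pub-nsfunc`, prove seat
(gen 8). HONEST SCOPE: this is an a priori differential inequality with an EXISTENTIAL constant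
`κ` (through the tree's Sobolev and Calderón–Zygmund constants); it closes only for small data
(DICTIONARY §7, TAO-BARRIER §4(f′)) and says nothing about regularity.

The K0 saturating law (`Candidates.SaturatingLaw F σ γ κ`, shape T_LD: along every zero-mean
classical solution of unforced Navier–Stokes on `T³`, `dF/dt ≤ κ ν^{−γ} (2ℰ) F^{1+1/σ}`,
`2ℰ = ‖∇u‖₂²`) for the velocity moment `F = U₄ = ∫|u|⁴` (`σ = 1`, `γ = 5`):

* `velocityL4_saturatingLaw : ∃ κ, SaturatingLaw (fun v => ∫ ‖v‖⁴) 1 5 κ`.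

This is the no-go seat's verdict "EV.s=4|T_LD|G1 HOLDS ∃κ" (SIEVELD.md §3.5, paper; dict K0-FLAGS
A12) as a tree theorem, next to `E.q=2` (Lu–Doering, tree) and `EF.s=2` (palinstrophy ladder, tree).
PROOF = the printed chain of SIEVELD §3.5 with every input a tree theorem:
(1) the exact `L⁴` balance (Robinson–Rodrigo–Sadowski 2016 Ex. 11.4; tree
`Torus.IsClassicalNSSolutionOn.hasDerivWithinAt_integral_normSq_pow`, `m = 2`):
`U̇ = −ν(4I + 2∫∑ₖ(∂ₖ|u|²)²) + 4∫p ∑ₖuₖ∂ₖ|u|²`, `I = ∫|u|²∑ₖ‖∂ₖu‖²`;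
(2) `4∫p∑ₖuₖ∂ₖ|u|² = −4∫|u|²⟪∇p,u⟫ ≤ 4√A₆ √(∫|∇p|²)` (`VelocityL4Production`), `A₆ = ∫|u|⁶`;
(3) `‖∇p‖₂ ≤ C_p‖(u·∇)u‖₂` (RRS Lemma 5.1; tree `Torus.exists_gradPressure_Ls_le_convect`) and
`‖(u·∇)u‖₂² ≤ I`; so `N² ≤ 16C_p² A₆ I` for the production `N`;
(4) `A₆ ≤ C₆ Z³` (mean-zero Sobolev, tree), `A₆⁴ ≤ U³A₁₂` (Cauchy–Schwarz twice) and
`A₁₂ ≤ C₁₂ I³` (`VelocityL4Interpolation`, through the EXPLICIT nonlinear Poincaré inequality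
`U ≤ 1968 d³ I` of `VelocityL4NonlinearPoincare`); hence `N⁶ ≤ K Z U² I⁵` (`production_pow_six_le`);
(5) Young/AM–GM `N ≤ (5/6)·4νI + K Z U²/(6144 ν⁵)` (`le_of_pow_six_le`), absorbed by `−4νI`.
[ours; elementary given the cited tree inputs]
-/

noncomputable section

open MeasureTheory Finset Set
open scoped InnerProductSpace RealInnerProductSpace ContDiff

namespace Summit.NavierStokesRegularity.FunctionalMining

open Literature.Analysis.FunctionSpaces Literature.Analysis.FunctionSpaces.Torus
  Literature.Analysis.FluidPDE

namespace VelocityL4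

variable {d : Type*} [Fintype d] [DecidableEq d]

/-! ## 1. Real arithmetic: from the four analytic inputs to `N⁶ ≤ K Z U² I⁵`, and Young -/

/-- **Exponent bookkeeping of SIEVELD §3.5 (`s = 4`) in polynomial form.** If `N² ≤ c₁A₆I`,
`A₆ ≤ c₂Z³`, `A₆⁴ ≤ U³A₁₂` and `A₁₂ ≤ c₃I³` (all quantities non-negative), then
`N⁶ ≤ c₁³(c₂+1)(c₃+1) · Z U² I⁵`. [ours; elementary] -/
theorem production_pow_six_le {N A₆ A₁₂ U Z I c₁ c₂ c₃ : ℝ} (hA : 0 ≤ A₆)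
    (hU : 0 ≤ U) (hZ : 0 ≤ Z) (hI : 0 ≤ I) (hc₁ : 0 ≤ c₁) (hc₂ : 0 ≤ c₂) (hc₃ : 0 ≤ c₃)
    (h1 : N ^ 2 ≤ c₁ * A₆ * I) (h2 : A₆ ≤ c₂ * Z ^ 3) (h3 : A₆ ^ 4 ≤ U ^ 3 * A₁₂)
    (h4 : A₁₂ ≤ c₃ * I ^ 3) :
    N ^ 6 ≤ c₁ ^ 3 * (c₂ + 1) * (c₃ + 1) * Z * U ^ 2 * I ^ 5 := by
  have hUA : 0 ≤ U ^ 3 * A₁₂ := (pow_nonneg hA 4).trans h3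
  -- `A₆⁹ ≤ c₂ c₃² Z³ U⁶ I⁶`
  have hA9 : A₆ ^ 9 ≤ c₂ * Z ^ 3 * (U ^ 3 * (c₃ * I ^ 3)) ^ 2 := by
    have e : A₆ ^ 9 = A₆ * (A₆ ^ 4) ^ 2 := by ring
    rw [e]
    have h3' : (A₆ ^ 4) ^ 2 ≤ (U ^ 3 * A₁₂) ^ 2 := pow_le_pow_left₀ (by positivity) h3 2
    have h4' : (U ^ 3 * A₁₂) ^ 2 ≤ (U ^ 3 * (c₃ * I ^ 3)) ^ 2 :=
      pow_le_pow_left₀ hUA (mul_le_mul_of_nonneg_left h4 (by positivity)) 2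
    calc A₆ * (A₆ ^ 4) ^ 2 ≤ (c₂ * Z ^ 3) * (U ^ 3 * (c₃ * I ^ 3)) ^ 2 :=
          mul_le_mul h2 (h3'.trans h4') (by positivity) (by positivity)
      _ = c₂ * Z ^ 3 * (U ^ 3 * (c₃ * I ^ 3)) ^ 2 := by ring
  -- `N¹⁸ ≤ c₁⁹ A₆⁹ I⁹ ≤ (K Z U² I⁵)³`
  have h18 : N ^ 18 ≤ (c₁ * A₆ * I) ^ 9 := by
    have := pow_le_pow_left₀ (sq_nonneg N) h1 9
    rw [← pow_mul] at this
    exact this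
  set K : ℝ := c₁ ^ 3 * (c₂ + 1) * (c₃ + 1) with hK
  have hK0 : 0 ≤ K := by positivity
  have hc₂' : c₂ ≤ (c₂ + 1) ^ 3 := by nlinarith [sq_nonneg c₂]
  have hc₃' : c₃ ^ 2 ≤ (c₃ + 1) ^ 3 := by nlinarith [sq_nonneg c₃]
  have hcube : N ^ 18 ≤ (K * Z * U ^ 2 * I ^ 5) ^ 3 := by
    calc N ^ 18 ≤ (c₁ * A₆ * I) ^ 9 := h18
      _ = c₁ ^ 9 * A₆ ^ 9 * I ^ 9 := by ring
      _ ≤ c₁ ^ 9 * (c₂ * Z ^ 3 * (U ^ 3 * (c₃ * I ^ 3)) ^ 2) * I ^ 9 := by gcongr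
      _ = c₁ ^ 9 * c₂ * c₃ ^ 2 * (Z ^ 3 * U ^ 6 * I ^ 15) := by ring
      _ ≤ c₁ ^ 9 * (c₂ + 1) ^ 3 * (c₃ + 1) ^ 3 * (Z ^ 3 * U ^ 6 * I ^ 15) := by gcongr
      _ = (K * Z * U ^ 2 * I ^ 5) ^ 3 := by rw [hK]; ring
  have hR0 : 0 ≤ K * Z * U ^ 2 * I ^ 5 := by positivity
  have e6 : N ^ 18 = (N ^ 6) ^ 3 := by ring
  rw [e6] at hcube
  exact le_of_pow_le_pow_left₀ three_ne_zero hR0 hcube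

/-- **Young / AM–GM at the exponents `(6, 6/5)`**: `N⁶ ≤ x y⁵` with `N, x, y ≥ 0` gives
`N ≤ x/6 + 5y/6`. [folklore] -/
theorem le_of_pow_six_le {N x y : ℝ} (hN : 0 ≤ N) (hx : 0 ≤ x) (hy : 0 ≤ y)
    (h : N ^ 6 ≤ x * y ^ 5) : N ≤ x / 6 + 5 * y / 6 := by
  have h6 : N = (N ^ 6) ^ ((6 : ℕ)⁻¹ : ℝ) := (Real.pow_rpow_inv_natCast hN (by norm_num)).symm
  have hmono : (N ^ 6) ^ ((6 : ℕ)⁻¹ : ℝ) ≤ (x * y ^ 5) ^ ((6 : ℕ)⁻¹ : ℝ) :=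
    Real.rpow_le_rpow (by positivity) h (by norm_num)
  have hsplit : (x * y ^ 5) ^ ((6 : ℕ)⁻¹ : ℝ) = x ^ (1 / 6 : ℝ) * y ^ (5 / 6 : ℝ) := by
    rw [Real.mul_rpow hx (by positivity)]
    have e1 : ((6 : ℕ)⁻¹ : ℝ) = 1 / 6 := by norm_num
    rw [e1]
    congr 1
    rw [show y ^ 5 = y ^ ((5 : ℕ) : ℝ) from (Real.rpow_natCast y 5).symm, ← Real.rpow_mul hy]
    norm_num
  have hAG : x ^ (1 / 6 : ℝ) * y ^ (5 / 6 : ℝ) ≤ (1 / 6) * x + (5 / 6) * y :=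
    Real.geom_mean_le_arith_mean2_weighted (by norm_num) (by norm_num) hx hy (by norm_num)
  rw [h6]
  calc (N ^ 6) ^ ((6 : ℕ)⁻¹ : ℝ) ≤ (x * y ^ 5) ^ ((6 : ℕ)⁻¹ : ℝ) := hmono
    _ = x ^ (1 / 6 : ℝ) * y ^ (5 / 6 : ℝ) := hsplit
    _ ≤ (1 / 6) * x + (5 / 6) * y := hAG
    _ = x / 6 + 5 * y / 6 := by ring

/-! ## 2. The static production bound at a time slice -/

/-- **Production bound (static).** On `T³` (`card d = 3`) with the tree's constants `C₆`
(mean-zero Sobolev) and `C_p` (`‖∇p‖₂ ≤ C_p‖(u·∇)u‖₂` at `r = 2` for the given pair `(u, p)`):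
for smooth zero-mean divergence-free `u` and smooth `p`, the pressure production of `∫|u|⁴`,
`N := 4|∫|u|²⟪∇p,u⟫|`, satisfies `N⁶ ≤ K · ‖∇u‖₂² (∫|u|⁴)² (∫|u|²∑ₖ‖∂ₖu‖²)⁵` with
`K = (16C_p²)³ (C₆+1) (C₁₂+1)`, `C₁₂ = 32(64C₆ + (1968 d³)³)`. [ours] -/
theorem production_bound {C₆ Cp : ℝ} (hC₆0 : 0 ≤ C₆) (hCp0 : 0 ≤ Cp)
    (hC₆ : ∀ v : UnitAddTorus d → EuclideanSpace ℝ d, IsSmooth v → HasZeroMean v →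
      ∫ x, ‖v x‖ ^ 6 ≤ C₆ * gradNormSq v ^ 3)
    {u : UnitAddTorus d → EuclideanSpace ℝ d} (hu : IsSmooth u) (h0 : HasZeroMean u)
    {p : UnitAddTorus d → ℝ} (hp : IsSmooth p)
    (hgrad : Real.sqrt (∫ x, ‖gradient p x‖ ^ 2) ≤
      Cp * Real.sqrt (∫ x, ‖convect u u x‖ ^ 2)) :
    (4 * |∫ x, ‖u x‖ ^ 2 * ⟪gradient p x, u x⟫|) ^ 6 ≤
      (16 * Cp ^ 2) ^ 3 * (C₆ + 1) * (32 * (64 * C₆ + (1968 * (Fintype.card d : ℝ) ^ 3) ^ 3) + 1) *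
        gradNormSq u * (∫ x, ‖u x‖ ^ 4) ^ 2 *
          (∫ x, ‖u x‖ ^ 2 * ∑ k, ‖partialDeriv k u x‖ ^ 2) ^ 5 := by
  set I : ℝ := ∫ x, ‖u x‖ ^ 2 * ∑ k, ‖partialDeriv k u x‖ ^ 2 with hI
  set U : ℝ := ∫ x, ‖u x‖ ^ 4 with hU
  set Z : ℝ := gradNormSq u with hZ
  set A₆ : ℝ := ∫ x, ‖u x‖ ^ 6 with hA₆
  set A₁₂ : ℝ := ∫ x, ‖u x‖ ^ 12 with hA₁₂
  set N : ℝ := 4 * |∫ x, ‖u x‖ ^ 2 * ⟪gradient p x, u x⟫| with hN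
  have huc : Continuous u := hu.continuous
  have hI0 : 0 ≤ I := integral_nonneg fun x => by positivity
  have hU0 : 0 ≤ U := integral_nonneg fun x => by positivity
  have hZ0 : 0 ≤ Z := gradNormSq_nonneg u
  have hA0 : 0 ≤ A₆ := integral_nonneg fun x => by positivity
  have hN0 : 0 ≤ N := by positivity
  -- (h1) `N² ≤ 16 Cp² A₆ I`
  have hconv : Real.sqrt (∫ x, ‖convect u u x‖ ^ 2) ≤ Real.sqrt I :=
    Real.sqrt_le_sqrt (integral_norm_convect_self_sq_le hu)
  have hNle : N ≤ 4 * (Real.sqrt A₆ * (Cp * Real.sqrt I)) := by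
    have h := abs_pressure_term_le hu hp
    calc N = 4 * |∫ x, ‖u x‖ ^ 2 * ⟪gradient p x, u x⟫| := rfl
      _ ≤ 4 * (Real.sqrt A₆ * Real.sqrt (∫ x, ‖gradient p x‖ ^ 2)) := by gcongr
      _ ≤ 4 * (Real.sqrt A₆ * (Cp * Real.sqrt I)) := by
          gcongr
          exact hgrad.trans (mul_le_mul_of_nonneg_left hconv hCp0)
  have h1 : N ^ 2 ≤ 16 * Cp ^ 2 * A₆ * I := by
    have hs := pow_le_pow_left₀ hN0 hNle 2
    have eA := Real.sq_sqrt hA0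
    have eI := Real.sq_sqrt hI0
    calc N ^ 2 ≤ (4 * (Real.sqrt A₆ * (Cp * Real.sqrt I))) ^ 2 := hs
      _ = 16 * Cp ^ 2 * (Real.sqrt A₆ ^ 2) * (Real.sqrt I ^ 2) := by ring
      _ = 16 * Cp ^ 2 * A₆ * I := by rw [eA, eI]
  -- (h2)–(h4)
  have h2 : A₆ ≤ C₆ * Z ^ 3 := hC₆ u hu h0
  have h3 : A₆ ^ 4 ≤ U ^ 3 * A₁₂ := integral_norm_pow_six_pow_four_le huc
  have h4 : A₁₂ ≤ 32 * (64 * C₆ + (1968 * (Fintype.card d : ℝ) ^ 3) ^ 3) * I ^ 3 :=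
    integral_norm_pow_twelve_le hC₆0 hC₆ hu h0
  exact production_pow_six_le hA0 hU0 hZ0 hI0 (by positivity) hC₆0 (by positivity) h1 h2 h3 h4

/-! ## 3. The `L⁴` balance at a time slice -/

/-- **Slice form of the exact `L⁴` balance** (tree `hasDerivWithinAt_integral_normSq_pow`, `m = 2`,
unforced): along a classical solution on `[a, b] × T^d` with `ν ≥ 0`, `s ↦ ∫‖u(s)‖⁴` is
differentiable within `[a, b]` at `t` and
`d/dt ∫‖u‖⁴ ≤ −4ν ∫‖u‖²∑ₖ‖∂ₖu‖² + 4 |∫‖u‖²⟪∇p, u⟫|`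
(the second viscous term `−2ν∫∑ₖ(∂ₖ|u|²)²` is dropped; the pressure term is rewritten by
`pressure_term_eq`). [cite: RobinsonRodrigoSadowski2016, Ch. 11 Exercise 11.4 eq. (11.19)] -/
theorem derivWithin_integral_norm_pow_four_le {a b ν : ℝ} (hab : a < b) (hν : 0 ≤ ν)
    {u : ℝ → UnitAddTorus d → EuclideanSpace ℝ d} {p : ℝ → UnitAddTorus d → ℝ}
    (hsol : IsClassicalNSSolutionOn (Icc a b) ν 0 u p) {t : ℝ} (ht : t ∈ Icc a b) :
    DifferentiableWithinAt ℝ (fun s => ∫ x, ‖u s x‖ ^ 4) (Icc a b) t ∧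
      derivWithin (fun s => ∫ x, ‖u s x‖ ^ 4) (Icc a b) t ≤
        -(4 * ν * ∫ x, ‖u t x‖ ^ 2 * ∑ k, ‖partialDeriv k (u t) x‖ ^ 2) +
          4 * |∫ x, ‖u t x‖ ^ 2 * ⟪gradient (p t) x, u t x⟫| := by
  have hut : IsSmooth (u t) := hsol.smooth_velocity.isSmooth_slice ht
  have hpt : IsSmooth (p t) := hsol.smooth_pressure.isSmooth_slice ht
  have hdiv : IsDivFree (u t) := hsol.divFree t ht
  have hD := hsol.hasDerivWithinAt_integral_normSq_pow hab 2 ht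
  have hF : (fun s => ∫ x, ‖u s x‖ ^ 4) = fun s => ∫ x, (‖u s x‖ ^ 2) ^ 2 := by
    funext s; exact integral_congr_ae (ae_of_all _ fun x => by ring)
  have hUD : UniqueDiffWithinAt ℝ (Icc a b) t := uniqueDiffOn_Icc hab t ht
  refine ⟨?_, ?_⟩
  · rw [hF]; exact hD.differentiableWithinAt
  rw [hF, hD.derivWithin hUD]
  obtain ⟨I, hI⟩ : ∃ I : ℝ, I = ∫ x, ‖u t x‖ ^ 2 * ∑ k, ‖partialDeriv k (u t) x‖ ^ 2 := ⟨_, rfl⟩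
  obtain ⟨I₂, hI₂⟩ : ∃ I₂ : ℝ, I₂ = ∫ x, ∑ k, partialDeriv k (fun y => ‖u t y‖ ^ 2) x ^ 2 :=
    ⟨_, rfl⟩
  obtain ⟨P, hP⟩ : ∃ P : ℝ, P = ∫ x, ‖u t x‖ ^ 2 * ⟪gradient (p t) x, u t x⟫ := ⟨_, rfl⟩
  have hI₂0 : 0 ≤ I₂ := by
    rw [hI₂]; exact integral_nonneg fun x => Finset.sum_nonneg fun k _ => sq_nonneg _
  have hV1 : ∫ x, (‖u t x‖ ^ 2) ^ (2 - 1) * ∑ k, ‖partialDeriv k (u t) x‖ ^ 2 = I := by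
    rw [hI]; refine integral_congr_ae (ae_of_all _ fun x => ?_); simp
  have hV2 : ∫ x, (‖u t x‖ ^ 2) ^ (2 - 2) *
      ∑ k, partialDeriv k (fun y => ‖u t y‖ ^ 2) x ^ 2 = I₂ := by
    rw [hI₂]; refine integral_congr_ae (ae_of_all _ fun x => ?_); simp
  have hPt : ∫ x, p t x * ((‖u t x‖ ^ 2) ^ (2 - 2) *
      ∑ k, u t x k * partialDeriv k (fun y => ‖u t y‖ ^ 2) x) = -P := by
    have e : ∫ x, p t x * ((‖u t x‖ ^ 2) ^ (2 - 2) *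
        ∑ k, u t x k * partialDeriv k (fun y => ‖u t y‖ ^ 2) x) =
        ∫ x, p t x * ∑ k, u t x k * partialDeriv k (fun y => ‖u t y‖ ^ 2) x :=
      integral_congr_ae (ae_of_all _ fun x => by simp)
    rw [e, hP]
    exact pressure_term_eq hut hdiv hpt
  have hf0 : ∫ x, (‖u t x‖ ^ 2) ^ (2 - 1) *
      ⟪u t x, (0 : ℝ → UnitAddTorus d → EuclideanSpace ℝ d) t x⟫ = 0 := by
    simp
  rw [← hI, ← hP, hV1, hV2, hPt, hf0]
  push_cast
  have hPle : -P ≤ |P| := neg_le_abs P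
  have hνI₂ : 0 ≤ ν * I₂ := mul_nonneg hν hI₂0
  nlinarith [hPle, hνI₂]

omit [DecidableEq d] in
/-- The tree's pressure-gradient bound at `r = 2`, read in square-root form. [folklore] -/
theorem sqrt_integral_sq_le_of_rpow {Cp : ℝ} {f g : UnitAddTorus d → ℝ}
    (h : (∫ x, f x ^ (2 : ℝ)) ^ (1 / (2 : ℝ)) ≤ Cp * (∫ x, g x ^ (2 : ℝ)) ^ (1 / (2 : ℝ))) :
    Real.sqrt (∫ x, f x ^ 2) ≤ Cp * Real.sqrt (∫ x, g x ^ 2) := by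
  have e1 : ∀ (g : UnitAddTorus d → ℝ), (∫ x, g x ^ (2 : ℝ)) ^ (1 / (2 : ℝ)) =
      Real.sqrt (∫ x, g x ^ 2) := by
    intro g
    rw [Real.sqrt_eq_rpow]
    congr 1
    exact integral_congr_ae (ae_of_all _ fun x => Real.rpow_two _)
  rw [e1 f, e1 g] at h
  exact h

/-! ## 4. The saturating law -/

/-- **K0 row `EV.s=4|T_LD|G1` HOLDS (∃κ), in the kernel.** There is a constant `κ` such that along
every zero-mean classical solution of the unforced Navier–Stokes equations on `T³` (`ν > 0`), at
every time of the window, `s ↦ ∫‖u(s)‖⁴` is differentiable within the window and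
`d/dt ∫‖u‖⁴ ≤ κ · ν^{−5} · ‖∇u‖₂² · (∫‖u‖⁴)²` — the cell's saturating law `T_LD` with
`σ = 1`, `γ = 5` for the velocity moment `U₄` (`Candidates.SaturatingLaw`). The constant is
existential through the tree's mean-zero Sobolev constant and the Calderón–Zygmund constant of
`Torus.exists_gradPressure_Ls_le_convect`; an a priori inequality, small-data closing only.
[ours; chain of SIEVELD §3.5 (`s = 4`) with tree inputs, cf. RobinsonRodrigoSadowski2016 Ex. 11.4–11.7] -/
theorem velocityL4_saturatingLaw :
    ∃ κ : ℝ, SaturatingLaw (d := d) (fun v => ∫ x, ‖v x‖ ^ 4) 1 5 κ := by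
  classical
  by_cases hd : Fintype.card d = 3
  swap
  · exact ⟨0, fun h => absurd h hd⟩
  haveI : Nonempty d := Fintype.card_pos_iff.mp (by omega)
  obtain ⟨C₆, hC₆0, hC₆⟩ := Torus.exists_integral_norm_pow_six_le_gradNormSq_cube (d := d) hd
  obtain ⟨Cp, hCp0, hCp⟩ := Torus.exists_gradPressure_Ls_le_convect (d := d) (r := 2) one_lt_two
  obtain ⟨K, hK⟩ : ∃ K : ℝ, K = (16 * Cp ^ 2) ^ 3 * (C₆ + 1) *
      (32 * (64 * C₆ + (1968 * (Fintype.card d : ℝ) ^ 3) ^ 3) + 1) := ⟨_, rfl⟩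
  have hK0 : 0 ≤ K := by rw [hK]; positivity
  refine ⟨K / 6144, ?_⟩
  intro _ ν hν a b hab u p hsol hmean t ht
  have hut : IsSmooth (u t) := hsol.smooth_velocity.isSmooth_slice ht
  have hpt : IsSmooth (p t) := hsol.smooth_pressure.isSmooth_slice ht
  have h0 : HasZeroMean (u t) := hmean t ht
  obtain ⟨hdiff, hle⟩ := derivWithin_integral_norm_pow_four_le hab hν.le hsol ht
  refine ⟨hdiff, ?_⟩
  show _ ≤ K / 6144 * ν ^ (-(5 : ℝ)) * (2 * torusEnstrophy (u t)) *
      (∫ x, ‖u t x‖ ^ 4) ^ (1 + (1 : ℝ)⁻¹)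
  -- opaque names for the slice quantities
  obtain ⟨I, hI⟩ : ∃ I : ℝ, I = ∫ x, ‖u t x‖ ^ 2 * ∑ k, ‖partialDeriv k (u t) x‖ ^ 2 := ⟨_, rfl⟩
  obtain ⟨U, hU⟩ : ∃ U : ℝ, U = ∫ x, ‖u t x‖ ^ 4 := ⟨_, rfl⟩
  obtain ⟨Z, hZ⟩ : ∃ Z : ℝ, Z = gradNormSq (u t) := ⟨_, rfl⟩
  obtain ⟨P, hP⟩ : ∃ P : ℝ, P = ∫ x, ‖u t x‖ ^ 2 * ⟪gradient (p t) x, u t x⟫ := ⟨_, rfl⟩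
  rw [← hI, ← hP] at hle
  have hI0 : 0 ≤ I := by rw [hI]; exact integral_nonneg fun x => by positivity
  have hU0 : 0 ≤ U := by rw [hU]; exact integral_nonneg fun x => by positivity
  have hZ0 : 0 ≤ Z := by rw [hZ]; exact gradNormSq_nonneg _
  -- `N⁶ ≤ K Z U² I⁵` for `N = 4|P|`
  have hgrad : Real.sqrt (∫ x, ‖gradient (p t) x‖ ^ 2) ≤
      Cp * Real.sqrt (∫ x, ‖convect (u t) (u t) x‖ ^ 2) :=
    sqrt_integral_sq_le_of_rpow (f := fun x => ‖gradient (p t) x‖)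
      (g := fun x => ‖convect (u t) (u t) x‖) (hCp hab hsol t ht)
  have h6 : (4 * |P|) ^ 6 ≤ K * Z * U ^ 2 * I ^ 5 := by
    rw [hK, hZ, hU, hI, hP]
    exact production_bound hC₆0 hCp0 hC₆ hut h0 hpt hgrad
  -- Young: `4|P| ≤ x/6 + 5y/6`, `x = K Z U²/(1024 ν⁵)`, `y = 4νI`
  obtain ⟨x, hx⟩ : ∃ x : ℝ, x = K * Z * U ^ 2 / (1024 * ν ^ 5) := ⟨_, rfl⟩
  obtain ⟨y, hy⟩ : ∃ y : ℝ, y = 4 * ν * I := ⟨_, rfl⟩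
  have hx0 : 0 ≤ x := by rw [hx]; positivity
  have hy0 : 0 ≤ y := by rw [hy]; positivity
  have hxy : x * y ^ 5 = K * Z * U ^ 2 * I ^ 5 := by
    rw [hx, hy]; field_simp; ring
  have hNle : 4 * |P| ≤ x / 6 + 5 * y / 6 :=
    le_of_pow_six_le (by positivity) hx0 hy0 (by rw [hxy]; exact h6)
  -- the budget in closed form
  have hbudget : K / 6144 * ν ^ (-(5 : ℝ)) * (2 * torusEnstrophy (u t)) *
      (∫ x, ‖u t x‖ ^ 4) ^ (1 + (1 : ℝ)⁻¹) = K * Z * U ^ 2 / (6144 * ν ^ 5) := by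
    have e1 : ν ^ (-(5 : ℝ)) = (ν ^ 5)⁻¹ := by
      rw [Real.rpow_neg hν.le, show (5 : ℝ) = ((5 : ℕ) : ℝ) by norm_num, Real.rpow_natCast]
    have e2 : (∫ x, ‖u t x‖ ^ 4) ^ (1 + (1 : ℝ)⁻¹) = U ^ 2 := by
      rw [← hU, show (1 : ℝ) + (1 : ℝ)⁻¹ = ((2 : ℕ) : ℝ) by norm_num, Real.rpow_natCast]
    have e3 : 2 * torusEnstrophy (u t) = Z := by
      rw [hZ, torusEnstrophy]; ring
    rw [e1, e2, e3]
    field_simp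
  rw [hbudget]
  have hxI : x / 6 + 5 * y / 6 = K * Z * U ^ 2 / (6144 * ν ^ 5) + 10 / 3 * ν * I := by
    rw [hx, hy]; ring
  have hνI : 0 ≤ ν * I := mul_nonneg hν.le hI0
  linarith [hNle, hxI, hνI, hle]

end VelocityL4

end Summit.NavierStokesRegularity.FunctionalMining
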